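import Mathlib.Data.Real.Basic
import Mathlib.Tactic.Linarith
import Mathlib.Tactic.IntervalCases
import Mathlib.Tactic.Positivity
import Mathlib.Tactic.Push
import Mathlib.Tactic.Ring
import HarnessLib

/-!
# R-W WINDOW-TABLE, Broberg `ℚ(√7)` rows — the three floor-free cell families of the mixed-fibre socket at a SYMBOLIC prime level `l ≥ 5`

PROOF-ONLY file (0 definitions, 0 `Prop` facts) of the abc-iut cell (seat abc-iut-w6-d055, gen 10): the elementary real inequalities
behind the all-type-A (`𝔭₃′`, `h = 24`: `e = 10·l·k`, `D = e − 1`, `ρin = e/2`, `ρout ≤ min(3⁴ − 4e, 3⁵ − 5e)`, `P = 12e/l`), all-type-C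
(`𝔭₄₇`, `h = 8`: `e = 15·l·k`, `D = e − 1`, `ρin = 1`, `ρout ≤ 47 − e`, `P = 4e/l`) and B-present (`P_B/e_B = 1/l`) cells of
abc-iut-w5-d180's socket `Thm311.Real.licence_settingPrVolSharp_of_mixedOrders_of_realises` for N. Broberg's point at EVERY level
`l ≥ 5`, every label `j = i + 1` with `2j + 1 ≤ l` and every multiple `k ≥ 1` (numerators, before division by `e > 0`). Classical
arithmetic only; nothing here is about Θ-data; no side taken on [IUTchIII] Cor. 3.12 or on any author; no abc claim.
-/

namespace Summit.ABC.IUTFork.Conditional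

/-- **All-A cell numerator, every level.** For `l ≥ 5`, `2(i+1)+1 ≤ l`, `k ≥ 1` and any `R ≤ min(81 − 40lk, 243 − 50lk)`:
`(i+1)²·120k − ((i+2)(10lk−1) − (10lk−1)) − (i+2)·5lk ≤ 120k − (i+2)·R`. For `l ≥ 17` the second bound suffices
(`10j² − 179j + 812 > 0`), for `l ≤ 16` the first (`j ≤ 7`: `84 + 63j − 10j² > 0`). [folklore] -/
theorem WRow.broberg_cellA_num (l i k : ℕ) (R : ℝ) (hl : 5 ≤ l) (hil : 2 * (i + 1) + 1 ≤ l) (hk : 1 ≤ k)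
    (hR1 : R ≤ 81 - 40 * (l : ℝ) * k) (hR2 : R ≤ 243 - 50 * (l : ℝ) * k) :
    (((i + 1 : ℕ) : ℝ) ^ 2 * (120 * (k : ℝ)) - ((((i + 2 : ℕ) : ℝ)) * (10 * (l : ℝ) * k - 1) - (10 * (l : ℝ) * k - 1))
        - ((i + 2 : ℕ) : ℝ) * (5 * (l : ℝ) * k)) ≤ 120 * (k : ℝ) - ((i + 2 : ℕ) : ℝ) * R := by
  have hk' : (1 : ℝ) ≤ k := by exact_mod_cast hk
  have hJ0 : (0 : ℝ) ≤ ((i + 1 : ℕ) : ℝ) := by positivity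
  have hJ2 : ((i + 2 : ℕ) : ℝ) = ((i + 1 : ℕ) : ℝ) + 1 := by push_cast; ring
  by_cases h17 : 17 ≤ l
  · -- symbolic: the exponent-5 bound
    have hl' : (17 : ℝ) ≤ l := by exact_mod_cast h17
    have hjl : 2 * ((i + 1 : ℕ) : ℝ) + 1 ≤ l := by exact_mod_cast hil
    set J : ℝ := ((i + 1 : ℕ) : ℝ) with hJ
    set L : ℝ := (l : ℝ) with hL
    set K : ℝ := (k : ℝ) with hK
    rw [hJ2]
    have h1 : 0 ≤ (L - 2 * J - 1) * K * J := by
      have : 0 ≤ L - 2 * J - 1 := by linarith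
      positivity
    have h2 : 0 ≤ (L - 17) * K := by
      have : 0 ≤ L - 17 := by linarith
      positivity
    have h3 : 0 ≤ (K - 1) * J ^ 2 := by
      have : 0 ≤ K - 1 := by linarith
      positivity
    have h4 : 0 ≤ (K - 1) * J := by
      have : 0 ≤ K - 1 := by linarith
      positivity
    have h5 : 0 ≤ (J + 1) * (243 - 50 * L * K - R) := by
      have : 0 ≤ 243 - 50 * L * K - R := by linarith
      positivity
    nlinarith [h1, h2, h3, h4, h5, sq_nonneg (20 * J - 179)]
  · -- `5 ≤ l ≤ 16` (so `i + 1 ≤ 7`): the exponent-4 bound, symbolic as well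
    push Not at h17
    have hi7 : ((i + 1 : ℕ) : ℝ) ≤ 7 := by
      have : i + 1 ≤ 7 := by omega
      exact_mod_cast this
    have hjl : 2 * ((i + 1 : ℕ) : ℝ) + 1 ≤ l := by exact_mod_cast hil
    set J : ℝ := ((i + 1 : ℕ) : ℝ) with hJ
    set L : ℝ := (l : ℝ) with hL
    set K : ℝ := (k : ℝ) with hK
    rw [hJ2]
    have h1 : 0 ≤ (L - 2 * J - 1) * K * J := by
      have : 0 ≤ L - 2 * J - 1 := by linarith
      positivity
    have h2 : 0 ≤ (L - 2 * J - 1) * K := by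
      have : 0 ≤ L - 2 * J - 1 := by linarith
      positivity
    have h3 : 0 ≤ (K - 1) * J * (145 - 10 * J) := by
      have : 0 ≤ K - 1 := by linarith
      have : 0 ≤ 145 - 10 * J := by linarith
      positivity
    have h4 : 0 ≤ (K - 1) := by linarith
    have h5 : 0 ≤ (J + 1) * (81 - 40 * L * K - R) := by
      have : 0 ≤ 81 - 40 * L * K - R := by linarith
      positivity
    have h6 : 0 ≤ (7 - J) * J := by
      have : 0 ≤ 7 - J := by linarith
      positivity
    nlinarith [h1, h2, h3, h4, h5, h6]

/-- **All-C cell numerator, every level.** For `2(i+1)+1 ≤ l`, `k ≥ 1` and any `R ≤ 47 − 15lk`: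
`(i+1)²·60k − ((i+2)(15lk−1) − (15lk−1)) − (i+2)·1 ≤ 60k − (i+2)·R`. [folklore] -/
theorem WRow.broberg_cellC_num (l i k : ℕ) (R : ℝ) (hil : 2 * (i + 1) + 1 ≤ l) (hk : 1 ≤ k)
    (hR : R ≤ 47 - 15 * (l : ℝ) * k) :
    (((i + 1 : ℕ) : ℝ) ^ 2 * (60 * (k : ℝ)) - ((((i + 2 : ℕ) : ℝ)) * (15 * (l : ℝ) * k - 1) - (15 * (l : ℝ) * k - 1))
        - ((i + 2 : ℕ) : ℝ) * 1) ≤ 60 * (k : ℝ) - ((i + 2 : ℕ) : ℝ) * R := by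
  have hk' : (1 : ℝ) ≤ k := by exact_mod_cast hk
  have hJ2 : ((i + 2 : ℕ) : ℝ) = ((i + 1 : ℕ) : ℝ) + 1 := by push_cast; ring
  have hjl : 2 * ((i + 1 : ℕ) : ℝ) + 1 ≤ l := by exact_mod_cast hil
  set J : ℝ := ((i + 1 : ℕ) : ℝ) with hJ
  have hJ0 : (0 : ℝ) ≤ J := by positivity
  set L : ℝ := (l : ℝ) with hL
  set K : ℝ := (k : ℝ) with hK
  rw [hJ2]
  have h1 : 0 ≤ (L - 2 * J - 1) * K * J := by
    have : 0 ≤ L - 2 * J - 1 := by linarith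
    positivity
  have h2 : 0 ≤ (L - 2 * J - 1) * K := by
    have : 0 ≤ L - 2 * J - 1 := by linarith
    positivity
  have h3 : 0 ≤ (K - 1) * J := by
    have : 0 ≤ K - 1 := by linarith
    positivity
  have h5 : 0 ≤ (J + 1) * (47 - 15 * L * K - R) := by
    have : 0 ≤ 47 - 15 * L * K - R := by linarith
    positivity
  nlinarith [h1, h2, h3, h5]

/-- **B-present cells, every level: the Θ-side `(i+1)²/l` is below `2(i+2)`** when `2(i+1)+1 ≤ l`. [folklore] -/
theorem WRow.broberg_cellB_side (l i : ℕ) (hil : 2 * (i + 1) + 1 ≤ l) :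
    (((i + 1 : ℕ) : ℝ) ^ 2) / (l : ℝ) ≤ 2 * (((i : ℕ) : ℝ) + 2) := by
  have hl0 : (0 : ℝ) < l := by
    have : 0 < l := by omega
    exact_mod_cast this
  have hjl : 2 * ((i + 1 : ℕ) : ℝ) + 1 ≤ l := by exact_mod_cast hil
  have hJ0 : (0 : ℝ) ≤ ((i + 1 : ℕ) : ℝ) := by positivity
  rw [div_le_iff₀ hl0]
  have hJ : ((i + 1 : ℕ) : ℝ) = ((i : ℕ) : ℝ) + 1 := by push_cast; ring
  rw [hJ] at hjl hJ0 ⊢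
  nlinarith [hjl, hJ0]

end Summit.ABC.IUTFork.Conditional
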